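import Literature.Analysis.Hypoelliptic.RieszSchwartz
import Literature.Analysis.Hypoelliptic.FourierSupBound
import Mathlib.Analysis.Distribution.Distribution
import HarnessLib

/-!
# Localized distributions have finite order: their Fourier-side functions lie in some `Ĥ^{-M}`

Analysis/Hypoelliptic support file serving the discharge of
`Literature.Analysis.Distribution.Hormander1967_thm11` (the interface between `𝓓'(Ω)` on the
`x`-space `E` and the weighted-`L²` calculus on the Fourier space `V`).

Let `u ∈ 𝓓'(Ω, ℝ)`, `ζ ∈ 𝓓(Ω, ℝ)` a cutoff and `T : E →L[ℝ] V` a linear map to a finite-dimensional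
inner product space (later: `toEuclidean`).

* `mulSmooth ζ g`: the test function `ζ · g` for smooth `g`; `toK`: the same as an element of
  `𝓓_K`, `K = tsupport ζ`.
* **Finite order** (`Distribution.exists_finiteOrder`): `|u f| ≤ C ∑_{i ≤ N} N_{K,i}(f)` on
  `𝓓_K` (Mathlib: `TestFunction.continuous_iff_continuous_comp`,
  `ContDiffMapSupportedIn.withSeminorms`, `Seminorm.bound_of_continuous`).
* **The Fourier-side functional** `fourierFun u ζ T : 𝓢(V, ℂ) → ℂ`,
  `ψ ↦ u(ζ · Re(𝓕ψ ∘ T)) - i u(ζ · Im(𝓕ψ ∘ T))`: conjugate-linear and bounded by `C ‖ψ‖_M`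
  (`norm_fourierFun_le`), hence (**`exists_fourierSide`**) represented as
  `pairing G ψ` by a function `G ∈ Ĥ^{-M}` — the Fourier-side avatar of the localized
  distribution `ζ u`.

## References

* L. Hörmander, *The Analysis of Linear Partial Differential Operators I*, Thm 2.1.8, §7.1
  (folklore).
-/

noncomputable section

open MeasureTheory Set Filter Function SchwartzMap TopologicalSpace Distributions TestFunction
open scoped ENNReal NNReal Topology ComplexConjugate InnerProductSpace FourierTransform BigOperators
  ContDiff

namespace Literature.Analysis.Hypoelliptic

variable {E : Type*} [NormedAddCommGroup E] [NormedSpace ℝ E] {Ω : Opens E}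

/-! ### Products of test functions with smooth functions -/

/-- The test function `ζ · g` for a cutoff `ζ ∈ 𝓓(Ω)` and a smooth `g`. [folklore] -/
def mulSmooth (ζ : 𝓓(Ω, ℝ)) (g : E → ℝ) (hg : ContDiff ℝ ∞ g) : 𝓓(Ω, ℝ) :=
  ⟨fun x => ζ x * g x, ζ.contDiff.mul hg, ζ.hasCompactSupport.mul_right,
    (tsupport_mul_subset_left).trans ζ.tsupport_subset⟩

/-- Pointwise formula. [folklore] -/
@[simp] theorem mulSmooth_apply (ζ : 𝓓(Ω, ℝ)) (g : E → ℝ) (hg : ContDiff ℝ ∞ g) (x : E) :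
    mulSmooth ζ g hg x = ζ x * g x := rfl

/-- `ζ · (g₁ + g₂) = ζ g₁ + ζ g₂`. [folklore] -/
theorem mulSmooth_add (ζ : 𝓓(Ω, ℝ)) {g₁ g₂ : E → ℝ} (h₁ : ContDiff ℝ ∞ g₁) (h₂ : ContDiff ℝ ∞ g₂) :
    mulSmooth ζ (fun x => g₁ x + g₂ x) (h₁.add h₂) = mulSmooth ζ g₁ h₁ + mulSmooth ζ g₂ h₂ := by
  ext x; simp [mul_add]

/-- `ζ · (c g) = c (ζ g)`. [folklore] -/
theorem mulSmooth_smul (ζ : 𝓓(Ω, ℝ)) {g : E → ℝ} (h : ContDiff ℝ ∞ g) (c : ℝ) :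
    mulSmooth ζ (fun x => c * g x) (contDiff_const.mul h) = c • mulSmooth ζ g h := by
  ext x; simp; ring

/-- `ζ · (-g) = -(ζ g)`. [folklore] -/
theorem mulSmooth_neg (ζ : 𝓓(Ω, ℝ)) {g : E → ℝ} (h : ContDiff ℝ ∞ g) :
    mulSmooth ζ (fun x => -g x) h.neg = -mulSmooth ζ g h := by
  ext x; simp

/-- Proof-irrelevant congruence. [folklore] -/
theorem mulSmooth_congr (ζ : 𝓓(Ω, ℝ)) {g g' : E → ℝ} (h : ContDiff ℝ ∞ g) (h' : ContDiff ℝ ∞ g')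
    (e : g = g') : mulSmooth ζ g h = mulSmooth ζ g' h' := by
  subst e; rfl

/-- The compact `K = tsupport ζ`. [folklore] -/
def suppK (ζ : 𝓓(Ω, ℝ)) : Compacts E := ⟨tsupport ζ, ζ.hasCompactSupport⟩

/-- `tsupport ζ ⊆ Ω`. [folklore] -/
theorem suppK_subset (ζ : 𝓓(Ω, ℝ)) : ((suppK ζ : Compacts E) : Set E) ⊆ Ω := ζ.tsupport_subset

/-- `ζ · g` as an element of `𝓓_K`, `K = tsupport ζ`. [folklore] -/
def toK (ζ : 𝓓(Ω, ℝ)) (g : E → ℝ) (hg : ContDiff ℝ ∞ g) : 𝓓_{suppK ζ}(E, ℝ) :=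
  ⟨fun x => ζ x * g x, ζ.contDiff.mul hg, fun x hx => by
    have : ζ x = 0 := image_eq_zero_of_notMem_tsupport hx
    simp [this]⟩

/-- `ζ` itself as an element of `𝓓_K`. [folklore] -/
def selfK (ζ : 𝓓(Ω, ℝ)) : 𝓓_{suppK ζ}(E, ℝ) :=
  ⟨ζ, ζ.contDiff, fun _ hx => image_eq_zero_of_notMem_tsupport hx⟩

/-- `ofSupportedIn (toK ζ g) = mulSmooth ζ g`. [folklore] -/
theorem ofSupportedIn_toK (ζ : 𝓓(Ω, ℝ)) (g : E → ℝ) (hg : ContDiff ℝ ∞ g) :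
    ofSupportedIn (suppK_subset ζ) (toK ζ g hg) = mulSmooth ζ g hg := by
  ext x; rfl

/-! ### Finite order of a distribution on a compact set -/

/-- **A distribution has finite order on each compact set**: `|u f| ≤ C ∑_{i ≤ N} N_{K,i}(f)` for
`f ∈ 𝓓_K`. [folklore] -/
theorem Distribution.exists_finiteOrder (u : 𝓓'(Ω, ℝ)) (K : Compacts E) (hK : (K : Set E) ⊆ Ω) :
    ∃ (N : ℕ) (C : ℝ), 0 ≤ C ∧ ∀ f : 𝓓_{K}(E, ℝ),
      ‖u (ofSupportedIn hK f)‖ ≤ C * ∑ i ∈ Finset.range (N + 1), (N[ℝ]_{K, i} f : ℝ) := by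
  -- continuity of `u ∘ ofSupportedIn`
  have hc : Continuous (u ∘ ofSupportedIn hK) :=
    (TestFunction.continuous_iff_continuous_comp (u : 𝓓(Ω, ℝ) →L[ℝ] ℝ).toLinearMap).1
      u.continuous K hK
  let L : 𝓓_{K}(E, ℝ) →ₗ[ℝ] ℝ := (u : 𝓓(Ω, ℝ) →L[ℝ] ℝ).toLinearMap ∘ₗ (ofSupportedInCLM ℝ hK).toLinearMap
  have hL : ∀ f, L f = u (ofSupportedIn hK f) := fun f => rfl
  let q : Seminorm ℝ 𝓓_{K}(E, ℝ) := (normSeminorm ℝ ℝ).comp L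
  have hq : Continuous q := by
    change Continuous fun f => ‖L f‖
    simp_rw [hL]
    exact continuous_norm.comp hc
  obtain ⟨s, C, _, hle⟩ := Seminorm.bound_of_continuous
    (ContDiffMapSupportedIn.withSeminorms ℝ E ℝ ⊤ K) q hq
  refine ⟨s.sup id, C, C.coe_nonneg, fun f => ?_⟩
  have h1 : ‖u (ofSupportedIn hK f)‖ = q f := rfl
  rw [h1]
  have h2 : q f ≤ (C : ℝ) * (s.sup (ContDiffMapSupportedIn.seminorm ℝ E ℝ ⊤ K)) f := by
    have := Seminorm.le_def.1 hle f
    simpa [NNReal.smul_def] using this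
  refine h2.trans (mul_le_mul_of_nonneg_left ?_ C.coe_nonneg)
  refine Seminorm.finset_sup_apply_le (Finset.sum_nonneg fun i _ => apply_nonneg _ _) fun i hi => ?_
  have hi' : i ∈ Finset.range (s.sup id + 1) :=
    Finset.mem_range.2 (Nat.lt_succ_of_le (Finset.le_sup (f := id) hi))
  exact Finset.single_le_sum (f := fun i => (N[ℝ]_{K, i} f : ℝ)) (fun i _ => apply_nonneg _ _) hi' 

/-! ### The Fourier-side functional of a localized distribution -/

variable {V : Type*} [NormedAddCommGroup V] [InnerProductSpace ℝ V] [FiniteDimensional ℝ V]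
  [MeasurableSpace V] [BorelSpace V]

/-- The smooth real functions `Re(𝓕ψ ∘ T)`, `Im(𝓕ψ ∘ T)` (through an `ℝ`-linear `ℓ : ℂ → ℝ`).
[folklore] -/
def compF (T : E →L[ℝ] V) (ℓ : ℂ →L[ℝ] ℝ) (ψ : 𝓢(V, ℂ)) : E → ℝ := fun x => ℓ (𝓕 ψ (T x))

/-- `compF` is smooth. [folklore] -/
theorem contDiff_compF (T : E →L[ℝ] V) (ℓ : ℂ →L[ℝ] ℝ) (ψ : 𝓢(V, ℂ)) :
    ContDiff ℝ ∞ (compF T ℓ ψ) :=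
  ℓ.contDiff.comp (((𝓕 ψ).smooth ⊤).comp T.contDiff)

/-- **The Fourier-side functional** of the localized distribution `ζ u`:
`ψ ↦ u(ζ · Re(𝓕ψ ∘ T)) - i · u(ζ · Im(𝓕ψ ∘ T))`. [folklore] -/
def fourierFun (u : 𝓓'(Ω, ℝ)) (ζ : 𝓓(Ω, ℝ)) (T : E →L[ℝ] V) (ψ : 𝓢(V, ℂ)) : ℂ :=
  (u (mulSmooth ζ (compF T Complex.reCLM ψ) (contDiff_compF T _ ψ)) : ℂ) -
    Complex.I * u (mulSmooth ζ (compF T Complex.imCLM ψ) (contDiff_compF T _ ψ))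

/-- The complexified action `Φ ↦ u(ζ Re Φ) - i u(ζ Im Φ)` as a function of the smooth
complex-valued `Φ`: here specialised to `Φ = 𝓕ψ ∘ T`; additivity. [folklore] -/
theorem fourierFun_add (u : 𝓓'(Ω, ℝ)) (ζ : 𝓓(Ω, ℝ)) (T : E →L[ℝ] V) (ψ φ : 𝓢(V, ℂ)) :
    fourierFun u ζ T (ψ + φ) = fourierFun u ζ T ψ + fourierFun u ζ T φ := by
  unfold fourierFun
  have hre : mulSmooth ζ (compF T Complex.reCLM (ψ + φ)) (contDiff_compF T _ _) =
      mulSmooth ζ (compF T Complex.reCLM ψ) (contDiff_compF T _ ψ) +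
        mulSmooth ζ (compF T Complex.reCLM φ) (contDiff_compF T _ φ) := by
    ext x; simp [compF, map_add, mul_add]
  have him : mulSmooth ζ (compF T Complex.imCLM (ψ + φ)) (contDiff_compF T _ _) =
      mulSmooth ζ (compF T Complex.imCLM ψ) (contDiff_compF T _ ψ) +
        mulSmooth ζ (compF T Complex.imCLM φ) (contDiff_compF T _ φ) := by
    ext x; simp [compF, map_add, mul_add]
  rw [hre, him, map_add, map_add]
  push_cast
  ring

/-- Conjugate homogeneity. [folklore] -/
theorem fourierFun_smul (u : 𝓓'(Ω, ℝ)) (ζ : 𝓓(Ω, ℝ)) (T : E →L[ℝ] V) (c : ℂ) (ψ : 𝓢(V, ℂ)) :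
    fourierFun u ζ T (c • ψ) = conj c * fourierFun u ζ T ψ := by
  unfold fourierFun
  set R := mulSmooth ζ (compF T Complex.reCLM ψ) (contDiff_compF T _ ψ) with hR
  set I := mulSmooth ζ (compF T Complex.imCLM ψ) (contDiff_compF T _ ψ) with hI
  have hre : mulSmooth ζ (compF T Complex.reCLM (c • ψ)) (contDiff_compF T _ _) = c.re • R - c.im • I := by
    ext x; simp [compF, hR, hI, Complex.mul_re]; ring
  have him : mulSmooth ζ (compF T Complex.imCLM (c • ψ)) (contDiff_compF T _ _) = c.re • I + c.im • R := by
    ext x; simp [compF, hR, hI, Complex.mul_im]; ring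
  rw [hre, him, map_sub, map_add, map_smul, map_smul, map_smul, map_smul]
  simp only [smul_eq_mul]
  push_cast
  have hc : (starRingEnd ℂ) c = (c.re : ℂ) - (c.im : ℂ) * Complex.I := Complex.ext (by simp) (by simp)
  rw [hc]
  linear_combination (-(c.im : ℂ) * ((u I : ℝ) : ℂ)) * Complex.I_sq

/-! ### The bound `|fourierFun ψ| ≤ C ‖ψ‖_M` -/

/-- Derivatives of `ℓ ∘ 𝓕ψ ∘ T`: `‖D^k (ℓ ∘ 𝓕ψ ∘ T)(x)‖ ≤ ‖ℓ‖ ‖T‖^k ‖D^k (𝓕ψ)(T x)‖`. [folklore] -/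
theorem norm_iteratedFDeriv_compF_le (T : E →L[ℝ] V) (ℓ : ℂ →L[ℝ] ℝ) (ψ : 𝓢(V, ℂ)) (k : ℕ) (x : E) :
    ‖iteratedFDeriv ℝ k (compF T ℓ ψ) x‖ ≤ ‖ℓ‖ * ‖T‖ ^ k * ‖iteratedFDeriv ℝ k (𝓕 (ψ : V → ℂ)) (T x)‖ := by
  have hF : ContDiff ℝ ∞ (𝓕 (ψ : V → ℂ)) := by
    have := (𝓕 ψ).smooth ⊤; rwa [SchwartzMap.fourier_coe] at this
  have hFT : ContDiff ℝ ∞ (fun x => 𝓕 (ψ : V → ℂ) (T x)) := hF.comp T.contDiff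
  have h1 : ‖iteratedFDeriv ℝ k (compF T ℓ ψ) x‖ ≤ ‖ℓ‖ * ‖iteratedFDeriv ℝ k (fun x => 𝓕 (ψ : V → ℂ) (T x)) x‖ := by
    have e : compF T ℓ ψ = ℓ ∘ fun x => 𝓕 (ψ : V → ℂ) (T x) := rfl
    rw [e]
    exact ℓ.norm_iteratedFDeriv_comp_left (hFT.contDiffAt) (mod_cast le_top)
  have h2 : ‖iteratedFDeriv ℝ k (fun x => 𝓕 (ψ : V → ℂ) (T x)) x‖ ≤
      ‖T‖ ^ k * ‖iteratedFDeriv ℝ k (𝓕 (ψ : V → ℂ)) (T x)‖ := by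
    have e : (fun x => 𝓕 (ψ : V → ℂ) (T x)) = 𝓕 (ψ : V → ℂ) ∘ T := rfl
    rw [e, T.iteratedFDeriv_comp_right hF x (mod_cast le_top)]
    refine (ContinuousMultilinearMap.norm_compContinuousLinearMap_le _ _).trans ?_
    rw [Finset.prod_const, Finset.card_univ, Fintype.card_fin, mul_comm]
  calc _ ≤ ‖ℓ‖ * ‖iteratedFDeriv ℝ k (fun x => 𝓕 (ψ : V → ℂ) (T x)) x‖ := h1
    _ ≤ ‖ℓ‖ * (‖T‖ ^ k * ‖iteratedFDeriv ℝ k (𝓕 (ψ : V → ℂ)) (T x)‖) :=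
        mul_le_mul_of_nonneg_left h2 (norm_nonneg _)
    _ = _ := by ring

/-- **Seminorm bound**: `N_{K,i}(ζ · ℓ(𝓕ψ ∘ T)) ≤ D_i ‖ψ‖_{i + r}` (`r > n/2`), with `D_i`
depending only on `ζ`, `ℓ`, `T`. [folklore] -/
theorem seminorm_toK_compF_le (ζ : 𝓓(Ω, ℝ)) (T : E →L[ℝ] V) (ℓ : ℂ →L[ℝ] ℝ) {r : ℝ}
    (hr : (Module.finrank ℝ V : ℝ) < 2 * r) (i : ℕ) :
    ∃ D : ℝ, 0 ≤ D ∧ ∀ ψ : 𝓢(V, ℂ),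
      (N[ℝ]_{suppK ζ, i} (toK ζ (compF T ℓ ψ) (contDiff_compF T ℓ ψ)) : ℝ) ≤ D * rn ((i : ℝ) + r) (ψ : V → ℂ) := by
  -- constants of the Fourier sup bounds, one per order `k ≤ i`
  choose C hC0 hC using fun k : ℕ => norm_iteratedFDeriv_fourier_le_rn (V := V) hr k
  set Z : ℕ → ℝ := fun m => (N[ℝ]_{suppK ζ, m} (selfK ζ) : ℝ) with hZ
  have hZ0 : ∀ m, 0 ≤ Z m := fun m => apply_nonneg _ _
  set D : ℝ := ∑ m ∈ Finset.range (i + 1), (i.choose m : ℝ) * Z m * (‖ℓ‖ * ‖T‖ ^ (i - m) * C (i - m)) with hD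
  have hD0 : 0 ≤ D := Finset.sum_nonneg fun m _ => by have := hZ0 m; have := hC0 (i - m); positivity
  refine ⟨D, hD0, fun ψ => ?_⟩
  have hψ := SchwartzMap.nice ψ
  refine (ContDiffMapSupportedIn.seminorm_top_le_iff ℝ (mul_nonneg hD0 (rn_nonneg _ _)) i _).2 fun x _ => ?_
  -- Leibniz
  have hg := contDiff_compF T ℓ ψ
  have hmul := norm_iteratedFDeriv_mul_le (ζ.contDiff) hg x (n := i) (mod_cast le_top)
  change ‖iteratedFDeriv ℝ i (fun y => ζ y * compF T ℓ ψ y) x‖ ≤ _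
  refine hmul.trans ?_
  rw [hD, Finset.sum_mul]
  refine Finset.sum_le_sum fun m hm => ?_
  have hmi : m ≤ i := Nat.lt_succ_iff.1 (Finset.mem_range.1 hm)
  -- `‖D^m ζ x‖ ≤ Z m`
  have h1 : ‖iteratedFDeriv ℝ m ζ x‖ ≤ Z m :=
    ContDiffMapSupportedIn.norm_iteratedFDeriv_apply_le_seminorm ℝ (f := selfK ζ) le_top
  -- `‖D^{i-m} g x‖ ≤ ‖ℓ‖ ‖T‖^{i-m} C_{i-m} ‖ψ‖_{i+r}`
  have h2 : ‖iteratedFDeriv ℝ (i - m) (compF T ℓ ψ) x‖ ≤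
      ‖ℓ‖ * ‖T‖ ^ (i - m) * C (i - m) * rn ((i : ℝ) + r) (ψ : V → ℂ) := by
    refine (norm_iteratedFDeriv_compF_le T ℓ ψ (i - m) x).trans ?_
    have h3 := hC (i - m) ψ (T x)
    have h4 : rn (((i - m : ℕ) : ℝ) + r) (ψ : V → ℂ) ≤ rn ((i : ℝ) + r) (ψ : V → ℂ) := by
      refine rn_mono ?_ hψ
      have : ((i - m : ℕ) : ℝ) ≤ (i : ℝ) := by exact_mod_cast Nat.sub_le i m
      linarith
    have := hC0 (i - m)
    calc ‖ℓ‖ * ‖T‖ ^ (i - m) * ‖iteratedFDeriv ℝ (i - m) (𝓕 (ψ : V → ℂ)) (T x)‖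
        ≤ ‖ℓ‖ * ‖T‖ ^ (i - m) * (C (i - m) * rn ((i : ℝ) + r) (ψ : V → ℂ)) :=
          mul_le_mul_of_nonneg_left (h3.trans (mul_le_mul_of_nonneg_left h4 this)) (by positivity)
      _ = _ := by ring
  have := hZ0 m; have := hC0 (i - m); have := rn_nonneg ((i : ℝ) + r) (ψ : V → ℂ)
  calc (i.choose m : ℝ) * ‖iteratedFDeriv ℝ m ζ x‖ * ‖iteratedFDeriv ℝ (i - m) (compF T ℓ ψ) x‖
      ≤ (i.choose m : ℝ) * Z m * (‖ℓ‖ * ‖T‖ ^ (i - m) * C (i - m) * rn ((i : ℝ) + r) (ψ : V → ℂ)) :=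
        mul_le_mul (mul_le_mul_of_nonneg_left h1 (Nat.cast_nonneg _)) h2 (norm_nonneg _) (by positivity)
    _ = _ := by ring

/-- **The bound of the Fourier-side functional**: `|fourierFun u ζ T ψ| ≤ C ‖ψ‖_M` for some
`M` and `C`. [folklore] -/
theorem norm_fourierFun_le (u : 𝓓'(Ω, ℝ)) (ζ : 𝓓(Ω, ℝ)) (T : E →L[ℝ] V) :
    ∃ (M C : ℝ), 0 ≤ C ∧ ∀ ψ : 𝓢(V, ℂ), ‖fourierFun u ζ T ψ‖ ≤ C * rn M (ψ : V → ℂ) := by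
  obtain ⟨N, Cu, hCu, hu⟩ := Distribution.exists_finiteOrder u (suppK ζ) (suppK_subset ζ)
  set r : ℝ := (Module.finrank ℝ V : ℝ) / 2 + 1 with hr
  have hr' : (Module.finrank ℝ V : ℝ) < 2 * r := by rw [hr]; linarith
  choose Dr hDr0 hDr using fun i => seminorm_toK_compF_le ζ T Complex.reCLM hr' i
  choose Di hDi0 hDi using fun i => seminorm_toK_compF_le ζ T Complex.imCLM hr' i
  refine ⟨(N : ℝ) + r, Cu * ∑ i ∈ Finset.range (N + 1), (Dr i + Di i),
    mul_nonneg hCu (Finset.sum_nonneg fun i _ => add_nonneg (hDr0 i) (hDi0 i)), fun ψ => ?_⟩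
  have hψ := SchwartzMap.nice ψ
  have hmono : ∀ i ∈ Finset.range (N + 1), rn ((i : ℝ) + r) (ψ : V → ℂ) ≤ rn ((N : ℝ) + r) (ψ : V → ℂ) :=
    fun i hi => rn_mono (by
      have : (i : ℝ) ≤ N := by exact_mod_cast Nat.lt_succ_iff.1 (Finset.mem_range.1 hi)
      linarith) hψ
  have hR := hu (toK ζ (compF T Complex.reCLM ψ) (contDiff_compF T _ ψ))
  have hI := hu (toK ζ (compF T Complex.imCLM ψ) (contDiff_compF T _ ψ))
  rw [ofSupportedIn_toK] at hR hI
  have hRb : ‖(u (mulSmooth ζ (compF T Complex.reCLM ψ) (contDiff_compF T _ ψ)) : ℝ)‖ ≤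
      Cu * (∑ i ∈ Finset.range (N + 1), Dr i) * rn ((N : ℝ) + r) (ψ : V → ℂ) := by
    refine hR.trans ?_
    rw [mul_assoc, Finset.sum_mul]
    refine mul_le_mul_of_nonneg_left (Finset.sum_le_sum fun i hi => ?_) hCu
    exact (hDr i ψ).trans (mul_le_mul_of_nonneg_left (hmono i hi) (hDr0 i))
  have hIb : ‖(u (mulSmooth ζ (compF T Complex.imCLM ψ) (contDiff_compF T _ ψ)) : ℝ)‖ ≤
      Cu * (∑ i ∈ Finset.range (N + 1), Di i) * rn ((N : ℝ) + r) (ψ : V → ℂ) := by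
    refine hI.trans ?_
    rw [mul_assoc, Finset.sum_mul]
    refine mul_le_mul_of_nonneg_left (Finset.sum_le_sum fun i hi => ?_) hCu
    exact (hDi i ψ).trans (mul_le_mul_of_nonneg_left (hmono i hi) (hDi0 i))
  unfold fourierFun
  calc _ ≤ ‖((u (mulSmooth ζ (compF T Complex.reCLM ψ) (contDiff_compF T _ ψ)) : ℝ) : ℂ)‖ +
        ‖Complex.I * (u (mulSmooth ζ (compF T Complex.imCLM ψ) (contDiff_compF T _ ψ)) : ℝ)‖ :=
        norm_sub_le _ _
    _ = ‖(u (mulSmooth ζ (compF T Complex.reCLM ψ) (contDiff_compF T _ ψ)) : ℝ)‖ +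
        ‖(u (mulSmooth ζ (compF T Complex.imCLM ψ) (contDiff_compF T _ ψ)) : ℝ)‖ := by
        rw [norm_mul, Complex.norm_I, one_mul, Complex.norm_real, Complex.norm_real]
    _ ≤ Cu * (∑ i ∈ Finset.range (N + 1), Dr i) * rn ((N : ℝ) + r) (ψ : V → ℂ) +
        Cu * (∑ i ∈ Finset.range (N + 1), Di i) * rn ((N : ℝ) + r) (ψ : V → ℂ) := add_le_add hRb hIb
    _ = _ := by rw [Finset.sum_add_distrib]; ring

/-- **The Fourier-side function of a localized distribution**: there are `M` and `G ∈ Ĥ^{-M}`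
with `pairing G ψ = fourierFun u ζ T ψ` for all Schwartz `ψ`. [folklore] -/
theorem exists_fourierSide (u : 𝓓'(Ω, ℝ)) (ζ : 𝓓(Ω, ℝ)) (T : E →L[ℝ] V) :
    ∃ (M : ℝ) (G : V → ℂ), InH (-M) G ∧ ∀ ψ : 𝓢(V, ℂ), pairing G ψ = fourierFun u ζ T ψ := by
  obtain ⟨M, C, _, hC⟩ := norm_fourierFun_le u ζ T
  obtain ⟨G, hG, hGp⟩ := exists_inH_pairing_eq (fourierFun u ζ T) (fourierFun_add u ζ T)
    (fourierFun_smul u ζ T) hC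
  exact ⟨M, G, hG, hGp⟩

end Literature.Analysis.Hypoelliptic
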